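/-
Copyright (c) 2026 the pub-hodgecm-mathlib formalisation cell (harness21).  Prover seat hodgecm-mathlib-K2E3-p17 (g6), Track B «K2-LIT» ∕ h413
(`stmt-HodgeConjecture-24833`), line `K2_E3_EllipticInputs`, unit U12 §L, Richardson road for (LBGL-ge3) at `N = 3` (road owner K2E3-p11),
brick (F-J) = (S-B♭)_Lie, FILE H1b «CHANGES OF VARIABLES FOR THE SPLIT ORBITAL MEASURE: `d = (d₀ + z) ∘ σ` ON `F³`, AND THE DIAGONAL∕OFF-DIAGONAL INVOLUTION».
2026-09-04.
-/
import Summits.HodgeConjecture.HodgeConjecture.Theorems.K2E3GL3SplitTorusWeylKit            -- ★ p857820 (this seat, H1a): `exists_perm_of_conj_diagonal_eq`, `Δ`-kit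
import Summits.HodgeConjecture.HodgeConjecture.Theorems.K2E3GL3RegularDiagonalOrbitChart  -- ★ p857634 (this seat, E2): boxes, `regular_of_isAddHaarMeasure`, LC∕2nd-countability kit
import Literature.MeasureTheory.Group.LocalFieldLinearJacobian                           -- ★ `addEquivAddHaarChar_eq_one_of_involutive`, `map_eq_addEquivAddHaarChar_inv_smul`
import HarnessLib

/-!
# K2_E3 road (h413), §L ∕ Richardson road at `N = 3`, brick (F-J) FILE H1b: two changes of variables

Cell `pub/hodgecm-mathlib` (D-0151), Track B, seat K2E3-p17 (g6), deal (D60) = (F-J) (road owner K2E3-p11).  `--supports stmt-HodgeConjecture-24833 --as helper`;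
THEOREMS ONLY (no definition ∕ instance ∕ notation ∕ named fact ∕ `sorry`); never imports `Cruxes/…/Lines`.  COUNT-NEUTRAL.  Serves FILE H1c (local density).

§1 **`exists_measurableEquiv_perm_add`**: for `d₀ ∈ F³`, `σ ∈ S₃`, the map `z ↦ (d₀ + z) ∘ σ` is a measurable automorphism of `F³` preserving `dx^{⊗3}`
(translation invariance + permutation of identical factors, checked on boxes via `Measure.pi_eq`).  **`disjoint_image_perm_add`**: at a level `k` separating
`d₀`, the six images of the box `(𝔭^k)³` are pairwise disjoint.  **`conj_diagonal_notMem_image_orbitChart`**: if `d` is injective and is none of the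
`(d₀ + z) ∘ σ` (`z ∈ (𝔭^k)³`), then no conjugate of `diag d` lies in the chart image `V_k(diag d₀)` (★ H1a `exists_perm_of_conj_diagonal_eq` + ★ E1).
§2 **`setLIntegral_box_offDiag_add_diagonal_eq`**: `∫_{z ∈ (𝔭^k)³} ∫_{X ∈ M₃(𝔭^k)} G(X⁺ + X⁻ + diag z) dμ𝔤 dz = dx(𝔭^k)³ · ∫_{M₃(𝔭^k)} G dμ𝔤` — the map
`(z, X) ↦ (X_d, X⁺ + X⁻ + diag z)` is a continuous additive INVOLUTION of `F³ × M₃(F)`, hence of Haar character `1` (★ `addEquivAddHaarChar_eq_one_of_involutive`),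
and it preserves the box; no product decomposition of `μ𝔤` is used.
[HarishChandra1999AdmissibleDistributions, Lemma 7.8] [WeilBNT1967, Ch. I §2] [HarishChandra1970, Part I §5]
HONEST LABEL: HC_CM is proved only modulo the 7 printed citations (2 remaining named inputs: hLiu418 = stmt-HodgeConjecture-24832, h413 = stmt-HodgeConjecture-24833)
until rung 0 closes; count-neutral helper.

## References
* [HarishChandra1999AdmissibleDistributions] Harish-Chandra (DeBacker–Sally), *Admissible Invariant Distributions on Reductive p-adic Groups* (1999), Lemma 7.8.
* [WeilBNT1967] A. Weil, *Basic Number Theory* (1967), Ch. I §2.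
* [HarishChandra1970] Harish-Chandra (van Dijk), *Harmonic Analysis on Reductive p-adic Groups*, LNM 162 (1970), Part I §5.
-/

set_option autoImplicit false
set_option linter.dupNamespace false

noncomputable section

open MeasureTheory Measure Filter Topology Set Matrix ValuativeRel
open scoped MatrixGroups NNReal ENNReal Valued
open Literature.NumberTheory.Automorphic Literature.NumberTheory.Automorphic.LocalFieldHaar
open Literature.NumberTheory.GaloisRepresentations Literature.NumberTheory.GaloisRepresentations.IsNonarchimedeanLocalField
open Summit.HodgeConjecture.HodgeConjecture.Cruxes.H413.K2E3GL3OrbitChartDeriv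
open Summit.HodgeConjecture.HodgeConjecture.Cruxes.H413.K2E3GL3OrbitChartStabilisers
open Summit.HodgeConjecture.HodgeConjecture.Cruxes.H413.K2E3GL3SplitTorusWeylKit

namespace Summit.HodgeConjecture.HodgeConjecture.Cruxes.H413.K2E3GL3SplitOrbitalChangeOfVariables

variable {F : Type*} [Field F] [ValuativeRel F] [TopologicalSpace F] [IsNonarchimedeanLocalField F]

/-! ## §1  `z ↦ (d₀ + z) ∘ σ` -/

section PermAdd

variable [MeasurableSpace F] [BorelSpace F]

/-- **`z ↦ (d₀ + z) ∘ σ` is a measurable automorphism of `F³` preserving `dx^{⊗3}`.** [cite: WeilBNT1967, Ch. I §2] -/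
theorem exists_measurableEquiv_perm_add (dx : Measure F) [dx.IsAddHaarMeasure] (d₀ : Fin 3 → F) (σ : Equiv.Perm (Fin 3)) :
    ∃ T : (Fin 3 → F) ≃ᵐ (Fin 3 → F), (∀ z, T z = (d₀ + z) ∘ σ) ∧
      MeasurePreserving T (Measure.pi fun _ : Fin 3 => dx) (Measure.pi fun _ : Fin 3 => dx) := by
  classical
  haveI : T2Space F := (isLocalField F).toT2Space
  haveI : SecondCountableTopology F := secondCountableTopology_localField F
  haveI : IsTopologicalRing F := inferInstance
  have hm1 : Measurable (fun z : Fin 3 → F => (d₀ + z) ∘ σ) :=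
    measurable_pi_lambda _ fun i => by
      have h : Measurable fun z : Fin 3 → F => z (σ i) := measurable_pi_apply (σ i)
      exact h.const_add (d₀ (σ i))
  have hm2 : Measurable (fun w : Fin 3 → F => w ∘ σ.symm - d₀) :=
    measurable_pi_lambda _ fun i => by
      have h : Measurable fun w : Fin 3 → F => w (σ.symm i) := measurable_pi_apply (σ.symm i)
      exact h.sub_const (d₀ i)
  set T : (Fin 3 → F) ≃ᵐ (Fin 3 → F) :=
    { toFun := fun z => (d₀ + z) ∘ σ
      invFun := fun w => w ∘ σ.symm - d₀
      left_inv := fun z => by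
        funext i; simp only [Function.comp_apply, Pi.sub_apply, Pi.add_apply, Equiv.apply_symm_apply, add_sub_cancel_left]
      right_inv := fun w => by
        funext i; simp only [Function.comp_apply, Equiv.symm_apply_apply, add_sub_cancel]
      measurable_toFun := hm1
      measurable_invFun := hm2 } with hT
  refine ⟨T, fun z => rfl, ⟨T.measurable, ?_⟩⟩
  symm
  refine Measure.pi_eq fun s hs => ?_
  rw [Measure.map_apply T.measurable (MeasurableSet.univ_pi hs)]
  have hpre : (T : (Fin 3 → F) → (Fin 3 → F)) ⁻¹' Set.pi univ s = Set.pi univ fun j => (fun x => d₀ j + x) ⁻¹' s (σ.symm j) := by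
    ext z
    simp only [Set.mem_preimage, Set.mem_univ_pi]
    constructor
    · intro h j
      have := h (σ.symm j)
      simp only [hT, MeasurableEquiv.coe_mk, Equiv.coe_fn_mk, Function.comp_apply, Equiv.apply_symm_apply, Pi.add_apply] at this
      exact this
    · intro h i
      have := h (σ i)
      simp only [Equiv.symm_apply_apply] at this
      simpa only [hT, MeasurableEquiv.coe_mk, Equiv.coe_fn_mk, Function.comp_apply, Pi.add_apply] using this
  rw [hpre, Measure.pi_pi]
  simp_rw [measure_preimage_add]
  exact Equiv.prod_comp σ.symm (fun i => dx (s i))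

omit [MeasurableSpace F] [BorelSpace F] in
/-- **At a separating level the six box images `{(d₀ + z) ∘ σ}` are pairwise disjoint.** [cite: HarishChandra1999AdmissibleDistributions, Lemma 7.8] -/
theorem eq_of_perm_add_eq {d₀ z z' : Fin 3 → F} {k : ℕ}
    (hsep : ∀ i j, i ≠ j → ((residueFieldCard F : ℝ≥0)⁻¹) ^ (k : ℤ) < normAbs F (d₀ i - d₀ j))
    (hz : ∀ i, z i ∈ primePowBall F k) (hz' : ∀ i, z' i ∈ primePowBall F k) {σ τ : Equiv.Perm (Fin 3)}
    (h : (d₀ + z) ∘ σ = (d₀ + z') ∘ τ) : σ = τ := by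
  ext i
  by_contra hne
  have h1 := congrFun h i
  simp only [Function.comp_apply, Pi.add_apply] at h1
  have h2 : d₀ (σ i) - d₀ (τ i) = z' (τ i) + -z (σ i) := by linear_combination h1
  have h3 : normAbs F (d₀ (σ i) - d₀ (τ i)) ≤ ((residueFieldCard F : ℝ≥0)⁻¹) ^ (k : ℤ) := by
    rw [h2]; exact mem_primePowBall_iff.1 (add_mem_primePowBall (hz' _) (neg_mem_primePowBall (hz _)))
  exact absurd (hsep _ _ (fun h' => hne (congrArg Fin.val h'))) (not_lt.2 h3)

omit [MeasurableSpace F] [BorelSpace F] in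
/-- Set form of `eq_of_perm_add_eq`. [cite: HarishChandra1999AdmissibleDistributions, Lemma 7.8] -/
theorem disjoint_image_perm_add {d₀ : Fin 3 → F} {k : ℕ}
    (hsep : ∀ i j, i ≠ j → ((residueFieldCard F : ℝ≥0)⁻¹) ^ (k : ℤ) < normAbs F (d₀ i - d₀ j)) {σ τ : Equiv.Perm (Fin 3)} (hστ : σ ≠ τ) :
    Disjoint ((fun z : Fin 3 → F => (d₀ + z) ∘ σ) '' {z | ∀ i, z i ∈ primePowBall F k})
      ((fun z : Fin 3 → F => (d₀ + z) ∘ τ) '' {z | ∀ i, z i ∈ primePowBall F k}) := by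
  rw [Set.disjoint_left]
  rintro _ ⟨z, hz, rfl⟩ ⟨z', hz', h⟩
  exact hστ (eq_of_perm_add_eq hsep hz hz' h.symm)

omit [MeasurableSpace F] [BorelSpace F] in
/-- **Off the six box images (and `d` injective) no conjugate of `diag d` lies in the chart image `V_k(diag d₀)`.**
[cite: HarishChandra1999AdmissibleDistributions, Lemma 7.8] [cite: HarishChandra1970, Part I §5] -/
theorem conj_diagonal_notMem_image_orbitChart (d₀ : Fin 3 → F) {k : ℕ} (Ψ : Matrix (Fin 3) (Fin 3) F → Matrix (Fin 3) (Fin 3) F)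
    (hΨ : Ψ = fun X : Matrix (Fin 3) (Fin 3) F =>
        (1 + !![0, X 0 1, X 0 2; 0, 0, X 1 2; 0, 0, 0]) * (1 + !![0, 0, 0; X 1 0, 0, 0; X 2 0, X 2 1, 0]) *
          (Matrix.diagonal d₀ + Matrix.diagonal (fun i => X i i)) *
          ((1 - !![0, 0, 0; X 1 0, 0, 0; X 2 0, X 2 1, 0] + !![0, 0, 0; X 1 0, 0, 0; X 2 0, X 2 1, 0] * !![0, 0, 0; X 1 0, 0, 0; X 2 0, X 2 1, 0]) *
            (1 - !![0, X 0 1, X 0 2; 0, 0, X 1 2; 0, 0, 0] + !![0, X 0 1, X 0 2; 0, 0, X 1 2; 0, 0, 0] * !![0, X 0 1, X 0 2; 0, 0, X 1 2; 0, 0, 0])))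
    {d : Fin 3 → F} (hd : Function.Injective d)
    (hnot : ∀ (σ : Equiv.Perm (Fin 3)) (z : Fin 3 → F), (∀ i, z i ∈ primePowBall F k) → d ≠ (d₀ + z) ∘ σ) (y : GL (Fin 3) F) :
    (y : Matrix (Fin 3) (Fin 3) F) * Matrix.diagonal d * ((y⁻¹ : GL (Fin 3) F) : Matrix (Fin 3) (Fin 3) F) ∉
      Ψ '' {X : Matrix (Fin 3) (Fin 3) F | ∀ i j, X i j ∈ primePowBall F k} := by
  rintro ⟨X, hX, hXy⟩
  obtain ⟨g, -, hg⟩ := exists_orbitChart_eq_conj d₀ X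
  have hΨX : Ψ X = (g : Matrix (Fin 3) (Fin 3) F) * Matrix.diagonal (d₀ + fun i => X i i) * ((g⁻¹ : GL (Fin 3) F) : Matrix (Fin 3) (Fin 3) F) := by
    rw [hΨ]; exact hg
  have hconj : Matrix.diagonal d = ((y⁻¹ * g : GL (Fin 3) F) : Matrix (Fin 3) (Fin 3) F) * Matrix.diagonal (d₀ + fun i => X i i) *
      (((y⁻¹ * g)⁻¹ : GL (Fin 3) F) : Matrix (Fin 3) (Fin 3) F) := by
    have h1 : Matrix.diagonal d = ((y⁻¹ : GL (Fin 3) F) : Matrix (Fin 3) (Fin 3) F) *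
        ((y : Matrix (Fin 3) (Fin 3) F) * Matrix.diagonal d * ((y⁻¹ : GL (Fin 3) F) : Matrix (Fin 3) (Fin 3) F)) * (y : Matrix (Fin 3) (Fin 3) F) := by
      rw [show ((y⁻¹ : GL (Fin 3) F) : Matrix (Fin 3) (Fin 3) F) * ((y : Matrix (Fin 3) (Fin 3) F) * Matrix.diagonal d *
          ((y⁻¹ : GL (Fin 3) F) : Matrix (Fin 3) (Fin 3) F)) * (y : Matrix (Fin 3) (Fin 3) F) =
          (((y⁻¹ : GL (Fin 3) F) : Matrix (Fin 3) (Fin 3) F) * (y : Matrix (Fin 3) (Fin 3) F)) * Matrix.diagonal d *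
          (((y⁻¹ : GL (Fin 3) F) : Matrix (Fin 3) (Fin 3) F) * (y : Matrix (Fin 3) (Fin 3) F)) by simp only [Matrix.mul_assoc],
        Units.inv_mul, Matrix.one_mul, Matrix.mul_one]
    rw [h1, ← hXy, hΨX, _root_.mul_inv_rev, inv_inv, Units.val_mul, Units.val_mul]
    simp only [Matrix.mul_assoc]
  obtain ⟨σ, hσ⟩ := exists_perm_of_conj_diagonal_eq hd (y⁻¹ * g) hconj
  exact hnot σ (fun i => X i i) (fun i => hX i i) hσ

end PermAdd

/-! ## §2  The diagonal ∕ off-diagonal involution -/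

section Involution

variable [MeasurableSpace F] [BorelSpace F] [MeasurableSpace (Matrix (Fin 3) (Fin 3) F)] [BorelSpace (Matrix (Fin 3) (Fin 3) F)]

/-- **`∫_{z ∈ (𝔭^k)³} ∫_{X ∈ M₃(𝔭^k)} G(X⁺ + X⁻ + diag z) dμ𝔤 dz = dx(𝔭^k)³ · ∫_{M₃(𝔭^k)} G dμ𝔤`** (the involution `(z, X) ↦ (X_d, X⁺ + X⁻ + diag z)` of `F³ × M₃(F)`
has Haar character `1` and preserves the box). [cite: WeilBNT1967, Ch. I §2] [cite: HarishChandra1999AdmissibleDistributions, Lemma 7.8] -/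
theorem setLIntegral_box_offDiag_add_diagonal_eq (dx : Measure F) [dx.IsAddHaarMeasure] (μ𝔤 : Measure (Matrix (Fin 3) (Fin 3) F)) [μ𝔤.IsAddHaarMeasure]
    (k : ℤ) (G : Matrix (Fin 3) (Fin 3) F → ℝ≥0∞) (hG : Measurable G) :
    ∫⁻ z in {z : Fin 3 → F | ∀ i, z i ∈ primePowBall F k},
        ∫⁻ X in {X : Matrix (Fin 3) (Fin 3) F | ∀ i j, X i j ∈ primePowBall F k},
          G ((!![0, X 0 1, X 0 2; 0, 0, X 1 2; 0, 0, 0] : Matrix (Fin 3) (Fin 3) F) + !![0, 0, 0; X 1 0, 0, 0; X 2 0, X 2 1, 0] + Matrix.diagonal z) ∂μ𝔤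
      ∂(Measure.pi fun _ : Fin 3 => dx) =
      dx (primePowBall F k) ^ 3 * ∫⁻ X in {X : Matrix (Fin 3) (Fin 3) F | ∀ i j, X i j ∈ primePowBall F k}, G X ∂μ𝔤 := by
  classical
  haveI : T2Space F := (isLocalField F).toT2Space
  haveI : LocallyCompactSpace F := (isLocalField F).toLocallyCompactSpace
  haveI : SecondCountableTopology F := secondCountableTopology_localField F
  haveI : IsTopologicalRing F := inferInstance
  haveI : SecondCountableTopology (Matrix (Fin 3) (Fin 3) F) := inferInstanceAs (SecondCountableTopology (Fin 3 → Fin 3 → F))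
  haveI : LocallyCompactSpace (Matrix (Fin 3) (Fin 3) F) := Pi.locallyCompactSpace_of_finite
  haveI : BorelSpace ((Fin 3 → F) × Matrix (Fin 3) (Fin 3) F) := Prod.borelSpace
  haveI : SFinite dx := inferInstance
  set ν : Measure ((Fin 3 → F) × Matrix (Fin 3) (Fin 3) F) := (Measure.pi fun _ : Fin 3 => dx).prod μ𝔤 with hν
  set bz : Set (Fin 3 → F) := {z : Fin 3 → F | ∀ i, z i ∈ primePowBall F k} with hbz
  set Box : Set (Matrix (Fin 3) (Fin 3) F) := {X : Matrix (Fin 3) (Fin 3) F | ∀ i j, X i j ∈ primePowBall F k} with hBox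
  -- the involution
  set φ : (Fin 3 → F) × Matrix (Fin 3) (Fin 3) F → (Fin 3 → F) × Matrix (Fin 3) (Fin 3) F := fun p => (fun i => p.2 i i,
    (!![0, p.2 0 1, p.2 0 2; 0, 0, p.2 1 2; 0, 0, 0] : Matrix (Fin 3) (Fin 3) F) + !![0, 0, 0; p.2 1 0, 0, 0; p.2 2 0, p.2 2 1, 0] + Matrix.diagonal p.1) with hφ
  have hφφ : ∀ p, φ (φ p) = p := by
    rintro ⟨z, X⟩
    refine Prod.ext ?_ ?_
    · funext i; fin_cases i <;> simp [hφ]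
    · ext i j; fin_cases i <;> fin_cases j <;> simp [hφ]
  have hφadd : ∀ p q, φ (p + q) = φ p + φ q := by
    rintro ⟨z, X⟩ ⟨z', X'⟩
    refine Prod.ext ?_ ?_
    · funext i; simp [hφ]
    · ext i j; fin_cases i <;> fin_cases j <;> simp [hφ, Matrix.add_apply]
  have hφc : Continuous φ := by
    refine Continuous.prodMk (continuous_pi fun i => ?_) ?_
    · exact (continuous_apply i).comp ((continuous_apply i).comp continuous_snd)
    · refine ((continuous_matrix fun i j => ?_).fun_add (continuous_matrix fun i j => ?_)).fun_add ?_
      · fin_cases i <;> fin_cases j <;> simp <;> fun_prop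
      · fin_cases i <;> fin_cases j <;> simp <;> fun_prop
      · exact continuous_matrix fun i j => by
          by_cases hij : i = j
          · subst hij; simp only [Matrix.diagonal_apply_eq]; exact (continuous_apply i).comp continuous_fst
          · simp only [Matrix.diagonal_apply_ne _ hij]; exact continuous_const
  set Φ : ((Fin 3 → F) × Matrix (Fin 3) (Fin 3) F) ≃ₜ+ ((Fin 3 → F) × Matrix (Fin 3) (Fin 3) F) :=
    { toFun := φ
      invFun := φ
      left_inv := hφφ
      right_inv := hφφ
      map_add' := hφadd
      continuous_toFun := hφc
      continuous_invFun := hφc } with hΦ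
  -- `ν` is a regular Haar measure and `Φ` preserves it
  haveI : SFinite μ𝔤 := inferInstance
  haveI : ν.IsAddHaarMeasure := by rw [hν]; exact Measure.prod.instIsAddHaarMeasure _ _
  haveI : ν.Regular := by
    have hK : IsCompact ((Set.pi univ fun _ : Fin 3 => (primePowBall F 0 : Set F)) ×ˢ {X : Matrix (Fin 3) (Fin 3) F | ∀ i j, X i j ∈ primePowBall F 0}) :=
      (isCompact_univ_pi fun _ => isCompact_primePowBall (F := F) 0).prod
        (Literature.MeasureTheory.Group.isCompact_setOf_forall_mem_primePowBall (F := F) (n := Fin 3) 0)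
    have hO : IsOpen ((Set.pi univ fun _ : Fin 3 => (primePowBall F 0 : Set F)) ×ˢ {X : Matrix (Fin 3) (Fin 3) F | ∀ i j, X i j ∈ primePowBall F 0}) :=
      (isOpen_set_pi Set.finite_univ fun _ _ => isOpen_primePowBall 0).prod
        (Literature.MeasureTheory.Group.isOpen_setOf_forall_mem_primePowBall (F := F) (n := Fin 3) 0)
    refine Measure.regular_of_isAddLeftInvariant hK ⟨0, ?_⟩ hK.measure_lt_top.ne
    rw [hO.interior_eq]
    exact ⟨Set.mem_univ_pi.2 fun i => zero_mem_primePowBall 0, fun i j => zero_mem_primePowBall 0⟩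
  have hmap : ν.map Φ = ν := by
    have h0 := Literature.MeasureTheory.Group.map_eq_addEquivAddHaarChar_inv_smul ν Φ
    rw [Literature.MeasureTheory.Group.addEquivAddHaarChar_eq_one_of_involutive Φ hφφ, inv_one, one_smul] at h0
    exact h0
  have hpres : MeasurePreserving Φ ν ν := ⟨Φ.continuous.measurable, hmap⟩
  have hemb : MeasurableEmbedding Φ := Φ.toHomeomorph.measurableEmbedding
  -- `Φ` preserves the box
  set s : Set ((Fin 3 → F) × Matrix (Fin 3) (Fin 3) F) := bz ×ˢ Box with hs
  have hinto : ∀ p ∈ s, φ p ∈ s := by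
    rintro ⟨z, X⟩ ⟨hz, hX⟩
    refine ⟨fun i => hX i i, fun i j => ?_⟩
    fin_cases i <;> fin_cases j <;> simp [hφ, hX _ _] <;> exact hz _
  have himage : (Φ : (Fin 3 → F) × Matrix (Fin 3) (Fin 3) F → (Fin 3 → F) × Matrix (Fin 3) (Fin 3) F) '' s = s := by
    refine Set.Subset.antisymm ?_ fun p hp => ⟨φ p, hinto p hp, hφφ p⟩
    rintro _ ⟨p, hp, rfl⟩; exact hinto p hp
  -- Tonelli on both sides
  have hbz_m : MeasurableSet bz := by
    have : bz = Set.pi univ fun _ => (primePowBall F k : Set F) := by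
      ext z; simp only [hbz, Set.mem_setOf_eq, Set.mem_univ_pi]
    rw [this]; exact MeasurableSet.univ_pi fun _ => measurableSet_primePowBall k
  have hG1 : Measurable fun p : (Fin 3 → F) × Matrix (Fin 3) (Fin 3) F => G (φ p).2 := hG.comp (measurable_snd.comp hφc.measurable)
  have hG2 : Measurable fun p : (Fin 3 → F) × Matrix (Fin 3) (Fin 3) F => G p.2 := hG.comp measurable_snd
  have hL : ∫⁻ z in bz, ∫⁻ X in Box,
        G ((!![0, X 0 1, X 0 2; 0, 0, X 1 2; 0, 0, 0] : Matrix (Fin 3) (Fin 3) F) + !![0, 0, 0; X 1 0, 0, 0; X 2 0, X 2 1, 0] + Matrix.diagonal z) ∂μ𝔤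
        ∂(Measure.pi fun _ : Fin 3 => dx) = ∫⁻ p in s, G (φ p).2 ∂ν := by
    rw [hs, hν, setLIntegral_prod _ hG1.aemeasurable]
  have hR : ∫⁻ p in s, G p.2 ∂ν = dx (primePowBall F k) ^ 3 * ∫⁻ X in Box, G X ∂μ𝔤 := by
    rw [hs, hν, setLIntegral_prod _ hG2.aemeasurable]
    simp only
    rw [setLIntegral_const, mul_comm]
    congr 1
    have : bz = Set.pi univ fun _ => (primePowBall F k : Set F) := by
      ext z; simp only [hbz, Set.mem_setOf_eq, Set.mem_univ_pi]
    rw [this, Measure.pi_pi, Finset.prod_const, Finset.card_univ, Fintype.card_fin]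
  rw [hL, ← hR]
  have h1 := hpres.setLIntegral_comp_emb hemb (fun p : (Fin 3 → F) × Matrix (Fin 3) (Fin 3) F => G p.2) s
  rw [himage] at h1
  exact h1

end Involution

end Summit.HodgeConjecture.HodgeConjecture.Cruxes.H413.K2E3GL3SplitOrbitalChangeOfVariables

end
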